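import Literature.NumberTheory.Rogawski1990.LocalTransferChartMatched              -- ★ p840336 F0P2-p02 (g8): `exists_transfer_of_unmatchedChart`
import Literature.NumberTheory.Rogawski1990.FinExplicitTransferFactorConjRight      -- ★ `isLocalNormPair_conj_right`
import Literature.NumberTheory.Rogawski1990.EndoscopicClassTransfer                 -- ★ `charpoly_endoEmb`
import Literature.NumberTheory.Automorphic.Liu2021.Def411WeilCarriersSurvivalNonsplit  -- ★ `UnitaryGroup.compactSpace_localPi_one_of_smul_eq`
import Literature.NumberTheory.Automorphic.UnitaryGroupLocalFactors                 -- ★ `UnitaryGroup.localPiEquiv`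
import Literature.LinearAlgebra.Matrix.RegularSemisimpleConjClassClosed             -- ★ `continuous_charpoly_coeff`
import HarnessLib

/-!
# The UNMATCHED LOCUS of the local transfer at a non-split place: the classes of `U(H′)(L⁺_v)` whose characteristic polynomial has no root `u(z)`, `z ∈ U(Φ₁)(L⁺_v)`,
# form an OPEN set matched by no `γ_H`, and there `ψ^H := 0` is a Δ-transfer (Rogawski 1990 §4.3, §3.6; the `J = ∅` charts of the (HLOC) junction)

Topic `NumberTheory/Rogawski1990`; namespace `Literature.NumberTheory.Rogawski1990`.  THEOREMS ONLY (no definition, no instance, no notation, no named fact, no `sorry`).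
Cell `pub/hodgecm-mathlib` (D-0151), crux H413 = stmt-HodgeConjecture-24833, F0∕P3a road «D-N6-ns», floor-2 letter N6-ns-reg, feeder (J-e-1) of the ONE junction file
`LocalTransferChartJunctionCM.lean` (LEAD F0P3a-plan (g9) T8-25 (B); ledger F0P3a-p08 (g13) cc0e73ef (J-e)); seat F0P2-p02 (g8).  HONEST LABEL: HC_CM is proved only modulo the
printed citations until rung 0 closes; this file proves no letter.

THE MATHEMATICS.  Write `u(z) ∈ L ⊗ L⁺_v` for the entry of `z ∈ U(Φ₁)(L⁺_v) ⊂ GL₁(L ⊗ L⁺_v)`.  If `γ_H = (A, z)` matches `γ ∈ U(H′)(L⁺_v)` (★ `IsLocalNormPair`: `ι_v(γ_H)` and `γ` are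
conjugate in `GL₃(L ⊗ L⁺_v)`) then `χ_γ = χ_{ι(γ_H)} = χ_A · (X − u(z))` (★ `Corresponds.charpoly_eq`, ★ `charpoly_endoEmb`), so `u(z)` is a root of `χ_γ` (§1).  Hence on the set
`U₀ := {γ | ∀ z, χ_γ(u(z)) ≠ 0}` no element is matched by any `γ_H` (§1), and `U₀` is OPEN (§2): `(γ, z) ↦ χ_γ(u(z))` is continuous (★ `continuous_charpoly_coeff`; a cubic is the
finite sum of its four coefficients) and `U(Φ₁)(L⁺_v)` is COMPACT at a non-split `v` (★ `compactSpace_localPi_one_of_smul_eq` through ★ `localPiEquiv`), so the projection of the closed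
zero set along the compact factor is closed.  §3: for `ψ ∈ C_c^∞(U(H′)(L⁺_v))` with `tsupport ψ ⊆ U₀`, `ψ^H := 0` is a Δ-transfer for ANY factor and families (★ `exists_transfer_of_unmatchedChart`
with ★ `isLocalNormPair_conj_right`).  NON-VACUOUS: the regular classes of `U(3)` in a «cubic-field» torus have irreducible `χ_γ` over `L_w`, hence lie in `U₀`.  (The complementary
statement «a regular class whose `χ_γ` HAS a root `u(z)` IS matched» — norm surjectivity onto the root locus, feeder (J-e-2) — is not in this file.)

* §1 `isRoot_charpoly_of_isLocalNormPair`, `not_isLocalNormPair_of_forall_not_isRoot`.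
* §2 `continuous_eval_charpoly_unitEntry`, `compactSpace_cmDatum_local_one_of_smul_eq`, `isOpen_setOf_forall_not_isRoot_charpoly`.
* §3 `exists_localTransfer_of_tsupport_subset_unmatched`.

## References
* [Rogawski1990] J. Rogawski, *Automorphic Representations of Unitary Groups in Three Variables*, Ann. of Math. Stud. 123 (1990): §4.3 (4.3.2) pp. 42–43; §3.6 pp. 30–31 (the tori of `U(3)`); §4.9 p. 54.
* [PlatonovRapinchuk1994] V. Platonov, A. Rapinchuk, *Algebraic Groups and Number Theory* (1994): §6.2 (`U(1)` of a local field is compact at a non-split place).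
-/

set_option autoImplicit false

noncomputable section

open Set Filter Topology MeasureTheory Polynomial
open scoped Pointwise

namespace Literature.NumberTheory.Rogawski1990

open Literature.NumberTheory.Automorphic Literature.NumberTheory.Automorphic.UnitaryGroup
open _root_.NumberField _root_.IsDedekindDomain

section Unmatched

variable (L : Type) [Field L] [NumberField L] [IsCMField L] (H' : Matrix (Fin 3) (Fin 3) L) (v : HeightOneSpectrum (𝓞 ↥(maximalRealSubfield L)))

/-! ## §1 A match forces a root -/

/-- **If `γ_H = (A, z)` matches `γ` then the entry `u(z)` of `z` is a root of `χ_γ`** (`χ_γ = χ_{ι(γ_H)} = χ_A · (X − u(z))`, ★ `Corresponds.charpoly_eq`, ★ `charpoly_endoEmb`).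
[cite: Rogawski1990, §4.3 p. 42] -/
theorem isRoot_charpoly_of_isLocalNormPair
    {γH : (cmDatum L 2 (Matrix.of fun i j : Fin 2 => if i.val + j.val + 1 = 2 then (1 : L) else 0)).Local v ×
      (cmDatum L 1 (Matrix.of fun i j : Fin 1 => if i.val + j.val + 1 = 1 then (1 : L) else 0)).Local v}
    {γ : (cmDatum L 3 H').Local v} (h : IsLocalNormPair L H' v γH γ) :
    ((γ.val.val : Matrix (Fin 3) (Fin 3) (UnitaryGroup.LocalRing L v)).charpoly).IsRoot
      (((γH.2.val.val : Matrix (Fin 1) (Fin 1) (UnitaryGroup.LocalRing L v))) 0 0) := by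
  have hc : ((γ.val.val : Matrix (Fin 3) (Fin 3) (UnitaryGroup.LocalRing L v)).charpoly) =
      ((γH.1.val.val : Matrix (Fin 2) (Fin 2) (UnitaryGroup.LocalRing L v)).charpoly) *
        (X - C (((γH.2.val.val : Matrix (Fin 1) (Fin 1) (UnitaryGroup.LocalRing L v))) 0 0)) := by
    rw [← Corresponds.charpoly_eq h]
    exact charpoly_endoEmb (endoForm_localForm L v) γH
  rw [Polynomial.IsRoot.def, hc, eval_mul, eval_sub, eval_X, eval_C, sub_self, mul_zero]

/-- **On the unmatched locus no `γ_H` matches**: if `χ_γ(u(z)) ≠ 0` for every `z ∈ U(Φ₁)(L⁺_v)` then `¬ IsLocalNormPair γ_H γ` for every `γ_H`. [cite: Rogawski1990, §4.3 p. 42; §3.6 p. 31] -/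
theorem not_isLocalNormPair_of_forall_not_isRoot {γ : (cmDatum L 3 H').Local v}
    (hγ : ∀ z : (cmDatum L 1 (Matrix.of fun i j : Fin 1 => if i.val + j.val + 1 = 1 then (1 : L) else 0)).Local v,
      ¬ ((γ.val.val : Matrix (Fin 3) (Fin 3) (UnitaryGroup.LocalRing L v)).charpoly).IsRoot
        (((z.val.val : Matrix (Fin 1) (Fin 1) (UnitaryGroup.LocalRing L v))) 0 0))
    (γH : (cmDatum L 2 (Matrix.of fun i j : Fin 2 => if i.val + j.val + 1 = 2 then (1 : L) else 0)).Local v ×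
      (cmDatum L 1 (Matrix.of fun i j : Fin 1 => if i.val + j.val + 1 = 1 then (1 : L) else 0)).Local v) :
    ¬ IsLocalNormPair L H' v γH γ :=
  fun h => hγ γH.2 (isRoot_charpoly_of_isLocalNormPair L H' v h)

/-! ## §2 The unmatched locus is open (compactness of `U(Φ₁)(L⁺_v)` at a non-split place) -/

/-- **`(γ, z) ↦ χ_γ(u(z))` is continuous** (the four coefficients of the cubic `χ_γ` are continuous in `γ`, ★ `continuous_charpoly_coeff`; the entry `u(z)` is continuous in `z`).
[cite: Rogawski1990, §4.3 p. 42] -/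
theorem continuous_eval_charpoly_unitEntry (w : PlacesOver L v) :
    Continuous fun p : (cmDatum L 3 H').Local v ×
        (cmDatum L 1 (Matrix.of fun i j : Fin 1 => if i.val + j.val + 1 = 1 then (1 : L) else 0)).Local v =>
      ((p.1.val.val : Matrix (Fin 3) (Fin 3) (UnitaryGroup.LocalRing L v)).charpoly).eval
        (((p.2.val.val : Matrix (Fin 1) (Fin 1) (UnitaryGroup.LocalRing L v))) 0 0) := by
  letI : Inhabited (PlacesOver L v) := ⟨w⟩
  haveI : Nontrivial (UnitaryGroup.LocalRing L v) := Pi.nontrivial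
  -- `γ ↦ its matrix` and `z ↦ u(z)` are continuous
  have hM : Continuous fun γ : (cmDatum L 3 H').Local v =>
      (γ.val.val : Matrix (Fin 3) (Fin 3) (UnitaryGroup.LocalRing L v)) :=
    Units.continuous_val.comp continuous_subtype_val
  have hu : Continuous fun z : (cmDatum L 1 (Matrix.of fun i j : Fin 1 => if i.val + j.val + 1 = 1 then (1 : L) else 0)).Local v =>
      ((z.val.val : Matrix (Fin 1) (Fin 1) (UnitaryGroup.LocalRing L v))) 0 0 :=
    (Units.continuous_val.comp continuous_subtype_val).matrix_elem 0 0
  -- a cubic is the sum of its first four coefficients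
  have hsum : Continuous fun p : (cmDatum L 3 H').Local v ×
        (cmDatum L 1 (Matrix.of fun i j : Fin 1 => if i.val + j.val + 1 = 1 then (1 : L) else 0)).Local v =>
      ∑ i ∈ Finset.range (3 + 1),
        ((p.1.val.val : Matrix (Fin 3) (Fin 3) (UnitaryGroup.LocalRing L v)).charpoly).coeff i *
          (((p.2.val.val : Matrix (Fin 1) (Fin 1) (UnitaryGroup.LocalRing L v))) 0 0) ^ i := by
    refine continuous_finsetSum _ fun i _ => ?_
    exact ((Literature.LinearAlgebra.Matrix.continuous_charpoly_coeff i).comp (hM.comp continuous_fst)).mul ((hu.comp continuous_snd).pow i)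
  refine hsum.congr fun p => (Polynomial.eval_eq_sum_range' ?_ _).symm
  rw [Matrix.charpoly_natDegree_eq_dim, Fintype.card_fin]
  exact Nat.lt_succ_self 3

/-- **`U(Φ₁)(L⁺_v)` is compact at a non-split place** on the `cmDatum` carrier (★ `compactSpace_localPi_one_of_smul_eq` through ★ `localPiEquiv`).
[cite: PlatonovRapinchuk1994, §6.2] -/
theorem compactSpace_cmDatum_local_one_of_smul_eq (w : PlacesOver L v) (hw : IsCMField.complexConj L • w.1 = w.1) :
    CompactSpace ((cmDatum L 1 (Matrix.of fun i j : Fin 1 => if i.val + j.val + 1 = 1 then (1 : L) else 0)).Local v) := by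
  haveI : Algebra.IsQuadraticExtension ↥(maximalRealSubfield L) L := IsCMField.isQuadraticExtension L
  haveI : CompactSpace (localPi L (IsCMField.complexConj L) 1 (Matrix.of fun i j : Fin 1 => if i.val + j.val + 1 = 1 then (1 : L) else 0) v) :=
    compactSpace_localPi_one_of_smul_eq (IsCMField.complexConj L) _ (IsCMField.complexConj_ne_one L) (by simp) w hw
  exact (localPiEquiv L (IsCMField.complexConj L) 1 (Matrix.of fun i j : Fin 1 => if i.val + j.val + 1 = 1 then (1 : L) else 0) v).toHomeomorph.compactSpace

/-- **THE UNMATCHED LOCUS IS OPEN** at a non-split `v`: `{γ ∈ U(H′)(L⁺_v) | ∀ z ∈ U(Φ₁)(L⁺_v), χ_γ(u(z)) ≠ 0}` is open — the complement is the projection along the COMPACT factor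
`U(Φ₁)(L⁺_v)` of the closed zero set of the continuous `(γ, z) ↦ χ_γ(u(z))`. [cite: Rogawski1990, §3.6 pp. 30–31] [cite: PlatonovRapinchuk1994, §6.2] -/
theorem isOpen_setOf_forall_not_isRoot_charpoly (w : PlacesOver L v) (hw : IsCMField.complexConj L • w.1 = w.1) :
    IsOpen {γ : (cmDatum L 3 H').Local v |
      ∀ z : (cmDatum L 1 (Matrix.of fun i j : Fin 1 => if i.val + j.val + 1 = 1 then (1 : L) else 0)).Local v,
        ¬ ((γ.val.val : Matrix (Fin 3) (Fin 3) (UnitaryGroup.LocalRing L v)).charpoly).IsRoot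
          (((z.val.val : Matrix (Fin 1) (Fin 1) (UnitaryGroup.LocalRing L v))) 0 0)} := by
  haveI := compactSpace_cmDatum_local_one_of_smul_eq L v w hw
  have hcl : IsClosed (Prod.fst '' {p : (cmDatum L 3 H').Local v ×
      (cmDatum L 1 (Matrix.of fun i j : Fin 1 => if i.val + j.val + 1 = 1 then (1 : L) else 0)).Local v |
      ((p.1.val.val : Matrix (Fin 3) (Fin 3) (UnitaryGroup.LocalRing L v)).charpoly).eval
        (((p.2.val.val : Matrix (Fin 1) (Fin 1) (UnitaryGroup.LocalRing L v))) 0 0) = 0}) :=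
    isClosedMap_fst_of_compactSpace _ (isClosed_singleton.preimage (continuous_eval_charpoly_unitEntry L H' v w))
  have heq : {γ : (cmDatum L 3 H').Local v |
      ∀ z : (cmDatum L 1 (Matrix.of fun i j : Fin 1 => if i.val + j.val + 1 = 1 then (1 : L) else 0)).Local v,
        ¬ ((γ.val.val : Matrix (Fin 3) (Fin 3) (UnitaryGroup.LocalRing L v)).charpoly).IsRoot
          (((z.val.val : Matrix (Fin 1) (Fin 1) (UnitaryGroup.LocalRing L v))) 0 0)} =
      (Prod.fst '' {p : (cmDatum L 3 H').Local v ×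
        (cmDatum L 1 (Matrix.of fun i j : Fin 1 => if i.val + j.val + 1 = 1 then (1 : L) else 0)).Local v |
        ((p.1.val.val : Matrix (Fin 3) (Fin 3) (UnitaryGroup.LocalRing L v)).charpoly).eval
          (((p.2.val.val : Matrix (Fin 1) (Fin 1) (UnitaryGroup.LocalRing L v))) 0 0) = 0})ᶜ := by
    ext γ
    simp only [Set.mem_setOf_eq, Set.mem_compl_iff, Set.mem_image, Prod.exists, exists_and_right, exists_eq_right, not_exists,
      Polynomial.IsRoot.def]
  rw [heq]
  exact hcl.isOpen_compl

/-! ## §3 On the unmatched locus `ψ^H := 0` is a Δ-transfer -/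

/-- **THE `J = ∅` CHART AT CM**: for every local transfer factor `Δ_v`, all families `m_H, m_G`, and every `ψ` on `U(H′)(L⁺_v)` with `tsupport ψ` inside the unmatched locus, `ψ^H := 0`
is a `Δ_v`-transfer of `ψ` (★ `exists_transfer_of_unmatchedChart`, ★ `isLocalNormPair_conj_right`). [cite: Rogawski1990, §4.3 (4.3.2) p. 43; §3.6 p. 31] -/
theorem exists_localTransfer_of_tsupport_subset_unmatched
    [∀ γ : (cmDatum L 3 H').Local v, MeasurableSpace ((cmDatum L 3 H').Local v ⧸ Subgroup.centralizer ({γ} : Set ((cmDatum L 3 H').Local v)))]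
    [∀ a : ((cmDatum L 2 (Matrix.of fun i j : Fin 2 => if i.val + j.val + 1 = 2 then (1 : L) else 0)).Local v ×
        (cmDatum L 1 (Matrix.of fun i j : Fin 1 => if i.val + j.val + 1 = 1 then (1 : L) else 0)).Local v),
      MeasurableSpace (((cmDatum L 2 (Matrix.of fun i j : Fin 2 => if i.val + j.val + 1 = 2 then (1 : L) else 0)).Local v ×
          (cmDatum L 1 (Matrix.of fun i j : Fin 1 => if i.val + j.val + 1 = 1 then (1 : L) else 0)).Local v) ⧸
        Subgroup.centralizer ({a} : Set ((cmDatum L 2 (Matrix.of fun i j : Fin 2 => if i.val + j.val + 1 = 2 then (1 : L) else 0)).Local v ×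
          (cmDatum L 1 (Matrix.of fun i j : Fin 1 => if i.val + j.val + 1 = 1 then (1 : L) else 0)).Local v)))]
    (T : LocalTransferFactor L H' v)
    (mH : OrbitalMeasureFamily ((cmDatum L 2 (Matrix.of fun i j : Fin 2 => if i.val + j.val + 1 = 2 then (1 : L) else 0)).Local v ×
      (cmDatum L 1 (Matrix.of fun i j : Fin 1 => if i.val + j.val + 1 = 1 then (1 : L) else 0)).Local v))
    (mG : OrbitalMeasureFamily ((cmDatum L 3 H').Local v)) {ψ : (cmDatum L 3 H').Local v → ℂ}
    (hψ : tsupport ψ ⊆ {γ : (cmDatum L 3 H').Local v |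
      ∀ z : (cmDatum L 1 (Matrix.of fun i j : Fin 1 => if i.val + j.val + 1 = 1 then (1 : L) else 0)).Local v,
        ¬ ((γ.val.val : Matrix (Fin 3) (Fin 3) (UnitaryGroup.LocalRing L v)).charpoly).IsRoot
          (((z.val.val : Matrix (Fin 1) (Fin 1) (UnitaryGroup.LocalRing L v))) 0 0)}) :
    ∃ ψH : (cmDatum L 2 (Matrix.of fun i j : Fin 2 => if i.val + j.val + 1 = 2 then (1 : L) else 0)).Local v ×
        (cmDatum L 1 (Matrix.of fun i j : Fin 1 => if i.val + j.val + 1 = 1 then (1 : L) else 0)).Local v → ℂ,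
      IsLocSmooth ψH ∧ IsLocalDeltaTransfer L H' v T mH mG ψH ψ :=
  exists_transfer_of_unmatchedChart (stA := IsLocalStablyConjH L v) (regA := IsLocalGRegular L v) T
    (fun a γ y h => (isLocalNormPair_conj_right L v H' a γ y).2 h) mH mG
    (fun _ hγ a => not_isLocalNormPair_of_forall_not_isRoot L H' v hγ a) hψ

end Unmatched

end Literature.NumberTheory.Rogawski1990

end
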